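import Summits.AnomalousDissipation.AnomalousDissipation.Theorems.SolenoidalFractalHomogenisationLagrangianStepCellClauseModDefs
import HarnessLib

/-!
# L-cmp — loss comparability from a pairing clause (certifier tool, planner ad-ideate-p5 g14, 2026-08-29)

Pure Hilbert-space facts about the loss forms `lossFwd T x = ‖x‖² − ‖T x‖²`, `lossAdj T ζ = ‖ζ‖² − ‖T† ζ‖²` of
`…LagrangianStepCellClauseModDefs`: if the pairing clause `|⟪(U − T) x, ζ⟫| ≤ η·√(lossFwd T x)·√(lossAdj T ζ)` holds at the single test
datum `ζ := T x`, then the TRUE loss is controlled by the COARSE loss, `lossFwd U x ≤ (1 + 2η)·lossFwd T x`; dually for `lossAdj`.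
No PDE, no contraction hypothesis on `U`.  (For the (ℓ3) memo L18: «true loss ≲ coarse loss» wherever a flat clause holds.)

Proof: `⟪U x, T x⟫ = ‖T x‖² + ⟪(U−T) x, T x⟫ ≥ ‖T x‖² − η·lossFwd T x` using `lossAdj T (T x) ≤ lossFwd T x`
(`‖T x‖² = ⟪T†T x, x⟫ ≤ ‖T†T x‖·‖x‖` and AM–GM), and `⟪U x, T x⟫ ≤ ‖U x‖·‖T x‖ ≤ (‖U x‖² + ‖T x‖²)/2`.
-/

set_option linter.dupNamespace false

noncomputable section

namespace Summit.AnomalousDissipation.AnomalousDissipation.Theorems.SolenoidalFractalHomogenisation.LagrangianStep.CellClauseMod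

open scoped InnerProductSpace

/-- `q*_T(T x) ≤ q_T(x)` for every bounded operator `T` (AM–GM on `‖T x‖² = ⟪T†(T x), x⟫ ≤ ‖T†(T x)‖·‖x‖`). -/
theorem lossAdj_apply_le_lossFwd (T : V2 →L[ℝ] V2) (x : V2) : lossAdj T (T x) ≤ lossFwd T x := by
  unfold lossAdj lossFwd
  have h1 : ‖T x‖ ^ 2 = ⟪ContinuousLinearMap.adjoint T (T x), x⟫_ℝ := by
    rw [ContinuousLinearMap.adjoint_inner_left, real_inner_self_eq_norm_sq]
  have h2 : ⟪ContinuousLinearMap.adjoint T (T x), x⟫_ℝ ≤ ‖ContinuousLinearMap.adjoint T (T x)‖ * ‖x‖ :=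
    real_inner_le_norm _ _
  nlinarith [sq_nonneg (‖ContinuousLinearMap.adjoint T (T x)‖ - ‖x‖)]

/-- `q_T(T† ζ) ≤ q*_T(ζ)` for every bounded operator `T` (the dual of `lossAdj_apply_le_lossFwd`). -/
theorem lossFwd_adjoint_apply_le_lossAdj (T : V2 →L[ℝ] V2) (ζ : V2) :
    lossFwd T (ContinuousLinearMap.adjoint T ζ) ≤ lossAdj T ζ := by
  unfold lossAdj lossFwd
  have h1 : ‖ContinuousLinearMap.adjoint T ζ‖ ^ 2 = ⟪T (ContinuousLinearMap.adjoint T ζ), ζ⟫_ℝ := by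
    rw [← ContinuousLinearMap.adjoint_inner_right, real_inner_self_eq_norm_sq]
  have h2 : ⟪T (ContinuousLinearMap.adjoint T ζ), ζ⟫_ℝ ≤ ‖T (ContinuousLinearMap.adjoint T ζ)‖ * ‖ζ‖ :=
    real_inner_le_norm _ _
  nlinarith [sq_nonneg (‖T (ContinuousLinearMap.adjoint T ζ)‖ - ‖ζ‖)]

/-- **L-cmp (forward).**  If `T` does not expand `x` and the pairing clause holds at the test datum `ζ := T x` with `0 ≤ η`, then
`lossFwd U x ≤ (1 + 2η)·lossFwd T x`. -/
theorem lossFwd_le_of_pairing {U T : V2 →L[ℝ] V2} {x : V2} (hTx : ‖T x‖ ≤ ‖x‖) {η : ℝ} (hη : 0 ≤ η)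
    (h : |⟪U x - T x, T x⟫_ℝ| ≤ η * Real.sqrt (lossFwd T x) * Real.sqrt (lossAdj T (T x))) :
    lossFwd U x ≤ (1 + 2 * η) * lossFwd T x := by
  have hq : 0 ≤ lossFwd T x := by
    unfold lossFwd
    nlinarith [norm_nonneg (T x), norm_nonneg x]
  have hs : Real.sqrt (lossAdj T (T x)) ≤ Real.sqrt (lossFwd T x) :=
    Real.sqrt_le_sqrt (lossAdj_apply_le_lossFwd T x)
  have hprod : η * Real.sqrt (lossFwd T x) * Real.sqrt (lossAdj T (T x)) ≤ η * lossFwd T x := by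
    calc η * Real.sqrt (lossFwd T x) * Real.sqrt (lossAdj T (T x))
        ≤ η * Real.sqrt (lossFwd T x) * Real.sqrt (lossFwd T x) := by gcongr
      _ = η * lossFwd T x := by rw [mul_assoc, Real.mul_self_sqrt hq]
  have hlow : ‖T x‖ ^ 2 - η * lossFwd T x ≤ ⟪U x, T x⟫_ℝ := by
    have h' := (abs_le.mp (h.trans hprod)).1
    rw [inner_sub_left, real_inner_self_eq_norm_sq] at h'
    linarith
  have hcs : ⟪U x, T x⟫_ℝ ≤ ‖U x‖ * ‖T x‖ := real_inner_le_norm _ _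
  unfold lossFwd at *
  nlinarith [sq_nonneg (‖U x‖ - ‖T x‖)]

/-- **L-cmp (adjoint).**  If `T†` does not expand `ζ` and the pairing clause holds at the datum `x := T† ζ` with `0 ≤ η`, then
`lossAdj U ζ ≤ (1 + 2η)·lossAdj T ζ`. -/
theorem lossAdj_le_of_pairing {U T : V2 →L[ℝ] V2} {ζ : V2} (hTζ : ‖ContinuousLinearMap.adjoint T ζ‖ ≤ ‖ζ‖) {η : ℝ} (hη : 0 ≤ η)
    (h : |⟪U (ContinuousLinearMap.adjoint T ζ) - T (ContinuousLinearMap.adjoint T ζ), ζ⟫_ℝ|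
      ≤ η * Real.sqrt (lossFwd T (ContinuousLinearMap.adjoint T ζ)) * Real.sqrt (lossAdj T ζ)) :
    lossAdj U ζ ≤ (1 + 2 * η) * lossAdj T ζ := by
  have hq : 0 ≤ lossAdj T ζ := by
    unfold lossAdj
    nlinarith [norm_nonneg (ContinuousLinearMap.adjoint T ζ), norm_nonneg ζ]
  have hs : Real.sqrt (lossFwd T (ContinuousLinearMap.adjoint T ζ)) ≤ Real.sqrt (lossAdj T ζ) :=
    Real.sqrt_le_sqrt (lossFwd_adjoint_apply_le_lossAdj T ζ)
  have hprod : η * Real.sqrt (lossFwd T (ContinuousLinearMap.adjoint T ζ)) * Real.sqrt (lossAdj T ζ) ≤ η * lossAdj T ζ := by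
    calc η * Real.sqrt (lossFwd T (ContinuousLinearMap.adjoint T ζ)) * Real.sqrt (lossAdj T ζ)
        ≤ η * Real.sqrt (lossAdj T ζ) * Real.sqrt (lossAdj T ζ) := by gcongr
      _ = η * lossAdj T ζ := by rw [mul_assoc, Real.mul_self_sqrt hq]
  -- `⟪U (T† ζ), ζ⟫ = ⟪T† ζ, U† ζ⟫` and `⟪T (T† ζ), ζ⟫ = ‖T† ζ‖²`
  have hlow : ‖ContinuousLinearMap.adjoint T ζ‖ ^ 2 - η * lossAdj T ζ
      ≤ ⟪ContinuousLinearMap.adjoint T ζ, ContinuousLinearMap.adjoint U ζ⟫_ℝ := by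
    have h' := (abs_le.mp (h.trans hprod)).1
    rw [inner_sub_left, ← ContinuousLinearMap.adjoint_inner_right U, ← ContinuousLinearMap.adjoint_inner_right T,
      real_inner_self_eq_norm_sq] at h'
    linarith
  have hcs : ⟪ContinuousLinearMap.adjoint T ζ, ContinuousLinearMap.adjoint U ζ⟫_ℝ
      ≤ ‖ContinuousLinearMap.adjoint T ζ‖ * ‖ContinuousLinearMap.adjoint U ζ‖ := real_inner_le_norm _ _
  unfold lossAdj at *
  nlinarith [sq_nonneg (‖ContinuousLinearMap.adjoint U ζ‖ - ‖ContinuousLinearMap.adjoint T ζ‖)]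

end Summit.AnomalousDissipation.AnomalousDissipation.Theorems.SolenoidalFractalHomogenisation.LagrangianStep.CellClauseMod

end
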